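import Mathlib.Analysis.Asymptotics.SpecificAsymptotics
import Mathlib.Analysis.SpecialFunctions.Log.Basic

/-!
# Beta / EriceFlowEnclosureCesaroTauberianSeq — THE (C,1) TAUBERIAN THEOREM FOR SEQUENCES (R. SCHMIDT 1925) WITH ITS ONE-SCALE ESTIMATE:
# A SLOWLY OSCILLATING SEQUENCE WITH A CESÀRO MEAN CONVERGES (pure [folklore] SERVICE for the BARE ∕ CUTOFF side of row L130; Mathlib only).
# For a real sequence a : ℕ → ℝ with partial sums `S n = Σ_{i<n} a i` and Cesàro means `σ n = n⁻¹·S n` (Mathlib's form in `Filter.Tendsto.cesaro`):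
#   §1 ONE SCALE — for N < J and `|a i − a N| ≤ w` on the window N ≤ i < J:  **`|a N − m| ≤ w + (J·E_J + N·E_N)∕(J − N)`**, E_n := |σ n − m|
#      (`one_scale`; the one-sided halves `upper_of_window` ∕ `lower_of_window` serve the one-sided theorem);
#   §2 SCHMIDT'S THEOREM AT ∞ — slow decrease `a N − ε ≤ a i` for N₀ ≤ N ≤ i ≤ qN (q = q(ε) > 1) and `σ n → m` ⟹ **`a n → m`**
#      (HEADLINE `tendsto_of_cesaro_slowlyDecreasing`); the two-sided case (SO) `|a i − a N| ≤ ε` (`tendsto_of_cesaro_slowlyOscillating`);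
#      convergent ⟹ (SO), log-Lipschitz ⟹ (SO), and **`σ n → m ⟺ a n → m`** in the class (SO) (`cesaro_iff_tendsto_of_slowlyOscillating`; ⟸ is Mathlib's
#      `Filter.Tendsto.cesaro`, no clause);
#   §3 PERTURBATION BY A NULL SEQUENCE — for d = u + e with u (SO) and e → 0: **`Cesàro(d) → m ⟺ d → m ⟺ u → m`** (`cesaro_add_null_iff`), and the
#      log-Lipschitz RATE form of §1 (`logLip_rate`).
# This is the discrete twin (at ∞) of P2 #50d `EriceFlowEnclosureCesaroTauberian` (functions at 0⁺) and of P2 #51a's one-scale estimate.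
# (β-flow team, prover 2 = lower ∕ positivity side, unit `b2b-balaban-beta-bflow-p2`, gen 36; module P2 #53a; no Erice sentence occurs)

HONEST FRAMING (page 1 of everything the β sub-cell writes): discharging `BetaPertH` makes Bałaban's UV stability UNCONDITIONAL — a
real constructive-QFT result; it is NOT the continuum limit and NOT the Clay problem.  HONEST DEPENDENCY (cell reorg 2026-08-19,
verbatim): «continuum YM on T⁴ ⇐ BetaPertH ∧ nine spine estimates (0/9 proved); BetaPertH ⇐ (D1) ∧ (D4) ∧ CAP+tail; G-an2-4 gates
asym, D1 and NE2/3/4.»  THIS MODULE DISCHARGES NOTHING and quotes nothing: [folklore] real analysis about real sequences (R. Schmidt,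
«Über divergente Folgen und lineare Mittelbildungen», Math. Z. 22 (1925) 89–152; G. H. Hardy, «Theorems relating to the summability and
convergence of slowly oscillating series», Proc. LMS (2) 8 (1910) 301–320; Hardy, Divergent Series (1949) §6.2–6.3, Thm 68).  Mathlib has the
Abelian direction only (`Filter.Tendsto.cesaro`); `lean search SlowlyOscillating|Tauberian.*seq` finds nothing for sequences in the tree.

THE POINT.  `S J − S N = Σ_{N≤i<J} a i` lies between `(J − N)(a N ∓ w)` when the window values stay within w of a N, and
`(S J − S N)∕(J − N) − m = (J(σ J − m) − N(σ N − m))∕(J − N)`; with J ≈ qN the right side is `≤ (q + 1)∕(q − 1)·max E`, which is small once the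
Cesàro means have settled, while w is small by slow oscillation.  One-sided slow decrease needs the upper window [N, ⌊qN⌋[ for the upper bound
and the lower window [⌈N∕q⌉, N[ for the lower bound (every i there has N ≤ q·i, so `a i − ε ≤ a N`).

WHAT THIS FILE PROVES (0 sorry, 0 def): §1 `sum_range_eq_mul_cesaro`, `window_lower`, `window_upper`, `quotient_sub_eq`, `quotient_abs_le`,
`upper_of_window`, `lower_of_window`, **`one_scale`**; §2 `upper_index`, `lower_index`, HEADLINE **`tendsto_of_cesaro_slowlyDecreasing`**, **`tendsto_of_cesaro_slowlyOscillating`**,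
`slowlyOscillating_of_tendsto`, `slowlyOscillating_of_logLip`, **`cesaro_iff_tendsto_of_slowlyOscillating`**; §3 `slowlyOscillating_add_null`,
**`cesaro_add_null_iff`**, `logLip_rate`.
NOT CLAIMED: other means (logarithmic, Abel — Littlewood ∕ Karamata); anything about β-functions (the consumer instantiates a = the 1∕K letter
deviation of (3.76)'s O(1) term along the bare couplings); `BetaPertH`; continuum; Clay.
-/

namespace Summit.QuantumFields.BalabanUV.Beta.EriceFlowEnclosureCesaroTauberianSeq

open Finset Filter Topology

noncomputable section

variable {a : ℕ → ℝ}

/-! ## §1 One scale: the window sum and the difference quotient of the partial sums -/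

/-- `S n = n·σ n` for Mathlib's Cesàro mean `σ n = n⁻¹·S n` (both sides vanish at n = 0). [folklore] -/
theorem sum_range_eq_mul_cesaro (a : ℕ → ℝ) (n : ℕ) :
    ∑ i ∈ range n, a i = (n : ℝ) * ((n : ℝ)⁻¹ * ∑ i ∈ range n, a i) := by
  rcases Nat.eq_zero_or_pos n with hn | hn
  · subst hn; simp
  · have hn' : (n : ℝ) ≠ 0 := Nat.cast_ne_zero.mpr (Nat.pos_iff_ne_zero.mp hn)
    rw [← mul_assoc, mul_inv_cancel₀ hn', one_mul]

/-- LOWER WINDOW BOUND: if `a N − w ≤ a i` for `N ≤ i < J` (N ≤ J) then `(J − N)(a N − w) ≤ S J − S N`. [folklore] -/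
theorem window_lower {N J : ℕ} (hNJ : N ≤ J) {w : ℝ} (hw : ∀ i, N ≤ i → i < J → a N - w ≤ a i) :
    ((J : ℝ) - N) * (a N - w) ≤ ∑ i ∈ range J, a i - ∑ i ∈ range N, a i := by
  rw [← sum_Ico_eq_sub _ hNJ]
  have h : ∑ _i ∈ Ico N J, (a N - w) ≤ ∑ i ∈ Ico N J, a i :=
    sum_le_sum fun i hi => hw i (mem_Ico.mp hi).1 (mem_Ico.mp hi).2
  have hc : ∑ _i ∈ Ico N J, (a N - w) = ((J : ℝ) - N) * (a N - w) := by
    rw [sum_const, Nat.card_Ico, nsmul_eq_mul, Nat.cast_sub hNJ]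
  linarith [hc]

/-- UPPER WINDOW BOUND: if `a i ≤ a N + w` for `N ≤ i < J` (N ≤ J) then `S J − S N ≤ (J − N)(a N + w)`. [folklore] -/
theorem window_upper {N J : ℕ} (hNJ : N ≤ J) {w : ℝ} (hw : ∀ i, N ≤ i → i < J → a i ≤ a N + w) :
    ∑ i ∈ range J, a i - ∑ i ∈ range N, a i ≤ ((J : ℝ) - N) * (a N + w) := by
  rw [← sum_Ico_eq_sub _ hNJ]
  have h : ∑ i ∈ Ico N J, a i ≤ ∑ _i ∈ Ico N J, (a N + w) :=
    sum_le_sum fun i hi => hw i (mem_Ico.mp hi).1 (mem_Ico.mp hi).2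
  have hc : ∑ _i ∈ Ico N J, (a N + w) = ((J : ℝ) - N) * (a N + w) := by
    rw [sum_const, Nat.card_Ico, nsmul_eq_mul, Nat.cast_sub hNJ]
  linarith [hc]

/-- THE QUOTIENT IDENTITY: `(S J − S N)∕(J − N) − m = (J(σ J − m) − N(σ N − m))∕(J − N)` for N < J. [folklore] -/
theorem quotient_sub_eq (a : ℕ → ℝ) {N J : ℕ} (hNJ : N < J) (m : ℝ) :
    (∑ i ∈ range J, a i - ∑ i ∈ range N, a i) / ((J : ℝ) - N) - m =
      ((J : ℝ) * ((J : ℝ)⁻¹ * ∑ i ∈ range J, a i - m) - N * ((N : ℝ)⁻¹ * ∑ i ∈ range N, a i - m)) / ((J : ℝ) - N) := by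
  have hJN : (J : ℝ) - N ≠ 0 := sub_ne_zero.mpr (Nat.cast_lt.mpr hNJ).ne'
  have h1 : (J : ℝ) * ((J : ℝ)⁻¹ * ∑ i ∈ range J, a i - m) = ∑ i ∈ range J, a i - J * m := by
    rw [mul_sub, ← sum_range_eq_mul_cesaro]
  have h2 : (N : ℝ) * ((N : ℝ)⁻¹ * ∑ i ∈ range N, a i - m) = ∑ i ∈ range N, a i - N * m := by
    rw [mul_sub, ← sum_range_eq_mul_cesaro]
  rw [h1, h2, eq_div_iff hJN, sub_mul, div_mul_cancel₀ _ hJN]; ring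

/-- THE QUOTIENT ESTIMATE: `|σ J − m| ≤ E₂`, `|σ N − m| ≤ E₁`, N < J ⟹ `|(S J − S N)∕(J − N) − m| ≤ (J·E₂ + N·E₁)∕(J − N)`. [folklore] -/
theorem quotient_abs_le {N J : ℕ} (hNJ : N < J) {m E₁ E₂ : ℝ}
    (hJ : |(J : ℝ)⁻¹ * ∑ i ∈ range J, a i - m| ≤ E₂) (hN : |(N : ℝ)⁻¹ * ∑ i ∈ range N, a i - m| ≤ E₁) :
    |(∑ i ∈ range J, a i - ∑ i ∈ range N, a i) / ((J : ℝ) - N) - m| ≤ ((J : ℝ) * E₂ + N * E₁) / ((J : ℝ) - N) := by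
  have hJN : 0 < (J : ℝ) - N := sub_pos.mpr (Nat.cast_lt.mpr hNJ)
  rw [quotient_sub_eq a hNJ m, abs_div, abs_of_pos hJN, div_le_div_iff_of_pos_right hJN]
  have hJ0 : 0 ≤ (J : ℝ) := Nat.cast_nonneg J
  have hN0 : 0 ≤ (N : ℝ) := Nat.cast_nonneg N
  calc |(J : ℝ) * ((J : ℝ)⁻¹ * ∑ i ∈ range J, a i - m) - N * ((N : ℝ)⁻¹ * ∑ i ∈ range N, a i - m)|
      ≤ |(J : ℝ) * ((J : ℝ)⁻¹ * ∑ i ∈ range J, a i - m)| + |(N : ℝ) * ((N : ℝ)⁻¹ * ∑ i ∈ range N, a i - m)| :=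
        abs_sub _ _
    _ = (J : ℝ) * |(J : ℝ)⁻¹ * ∑ i ∈ range J, a i - m| + N * |(N : ℝ)⁻¹ * ∑ i ∈ range N, a i - m| := by
        rw [abs_mul, abs_mul, abs_of_nonneg hJ0, abs_of_nonneg hN0]
    _ ≤ (J : ℝ) * E₂ + N * E₁ := add_le_add (mul_le_mul_of_nonneg_left hJ hJ0) (mul_le_mul_of_nonneg_left hN hN0)

/-- **UPPER BOUND FROM THE UPPER WINDOW** (one-sided): N < J, `a N − w ≤ a i` for `N ≤ i < J`, `|σ J − m| ≤ E₂`, `|σ N − m| ≤ E₁` ⟹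
`a N ≤ m + w + (J·E₂ + N·E₁)∕(J − N)`. [folklore] -/
theorem upper_of_window {N J : ℕ} (hNJ : N < J) {w m E₁ E₂ : ℝ} (hw : ∀ i, N ≤ i → i < J → a N - w ≤ a i)
    (hJ : |(J : ℝ)⁻¹ * ∑ i ∈ range J, a i - m| ≤ E₂) (hN : |(N : ℝ)⁻¹ * ∑ i ∈ range N, a i - m| ≤ E₁) :
    a N ≤ m + w + ((J : ℝ) * E₂ + N * E₁) / ((J : ℝ) - N) := by
  have hJN : 0 < (J : ℝ) - N := sub_pos.mpr (Nat.cast_lt.mpr hNJ)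
  have h1 := window_lower hNJ.le hw
  have h2 := (abs_le.mp (quotient_abs_le hNJ hJ hN)).2
  have h3 : a N - w ≤ (∑ i ∈ range J, a i - ∑ i ∈ range N, a i) / ((J : ℝ) - N) := by
    rw [le_div_iff₀ hJN]; linarith
  linarith

/-- **LOWER BOUND FROM THE LOWER WINDOW** (one-sided): I < N, `a i − w ≤ a N` for `I ≤ i < N`, `|σ N − m| ≤ E₁`, `|σ I − m| ≤ E₀` ⟹
`m − w − (N·E₁ + I·E₀)∕(N − I) ≤ a N`. [folklore] -/
theorem lower_of_window {I N : ℕ} (hIN : I < N) {w m E₀ E₁ : ℝ} (hw : ∀ i, I ≤ i → i < N → a i - w ≤ a N)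
    (hN : |(N : ℝ)⁻¹ * ∑ i ∈ range N, a i - m| ≤ E₁) (hI : |(I : ℝ)⁻¹ * ∑ i ∈ range I, a i - m| ≤ E₀) :
    m - w - ((N : ℝ) * E₁ + I * E₀) / ((N : ℝ) - I) ≤ a N := by
  have hNI : 0 < (N : ℝ) - I := sub_pos.mpr (Nat.cast_lt.mpr hIN)
  -- on the lower window every value is ≤ a N + w, a bound by the constant a N + w (not by a I + w)
  have h1 : ∑ i ∈ range N, a i - ∑ i ∈ range I, a i ≤ ((N : ℝ) - I) * (a N + w) := by
    rw [← sum_Ico_eq_sub _ hIN.le]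
    have h : ∑ i ∈ Ico I N, a i ≤ ∑ _i ∈ Ico I N, (a N + w) :=
      sum_le_sum fun i hi => by have := hw i (mem_Ico.mp hi).1 (mem_Ico.mp hi).2; linarith
    have hc : ∑ _i ∈ Ico I N, (a N + w) = ((N : ℝ) - I) * (a N + w) := by
      rw [sum_const, Nat.card_Ico, nsmul_eq_mul, Nat.cast_sub hIN.le]
    linarith [hc]
  have h2 := (abs_le.mp (quotient_abs_le hIN hN hI)).1
  have h3 : (∑ i ∈ range N, a i - ∑ i ∈ range I, a i) / ((N : ℝ) - I) ≤ a N + w := by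
    rw [div_le_iff₀ hNI]; linarith
  linarith

/-- **ONE SCALE (two-sided).**  N < J, `|a i − a N| ≤ w` for `N ≤ i < J`, `|σ J − m| ≤ E₂`, `|σ N − m| ≤ E₁` ⟹
**`|a N − m| ≤ w + (J·E₂ + N·E₁)∕(J − N)`** — the discrete twin of P2 #51a `one_scale`. [folklore] (R. Schmidt 1925) -/
theorem one_scale {N J : ℕ} (hNJ : N < J) {w m E₁ E₂ : ℝ} (hw : ∀ i, N ≤ i → i < J → |a i - a N| ≤ w)
    (hJ : |(J : ℝ)⁻¹ * ∑ i ∈ range J, a i - m| ≤ E₂) (hN : |(N : ℝ)⁻¹ * ∑ i ∈ range N, a i - m| ≤ E₁) :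
    |a N - m| ≤ w + ((J : ℝ) * E₂ + N * E₁) / ((J : ℝ) - N) := by
  have hJN : 0 < (J : ℝ) - N := sub_pos.mpr (Nat.cast_lt.mpr hNJ)
  have hup := upper_of_window (w := w) hNJ (fun i h1 h2 => by have := (abs_le.mp (hw i h1 h2)).1; linarith) hJ hN
  have h1 := window_upper (w := w) hNJ.le (fun i h1 h2 => by have := (abs_le.mp (hw i h1 h2)).2; linarith)
  have h2 := (abs_le.mp (quotient_abs_le hNJ hJ hN)).1
  have h3 : (∑ i ∈ range J, a i - ∑ i ∈ range N, a i) / ((J : ℝ) - N) ≤ a N + w := by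
    rw [div_le_iff₀ hJN]; linarith
  rw [abs_le]; constructor <;> linarith

/-! ## §2 Schmidt's Tauberian theorem for Cesàro means of sequences -/

/-- The upper window index: for q > 1 and `(q − 1)·N ≥ 2`, `J := ⌊q·N⌋₊` has `N < J`, `J ≤ q·N` and `(q − 1)·N∕2 ≤ J − N`. [folklore] -/
theorem upper_index {q : ℝ} (hq : 1 < q) {N : ℕ} (hN : 2 ≤ (q - 1) * N) :
    N < ⌊q * (N : ℝ)⌋₊ ∧ (⌊q * (N : ℝ)⌋₊ : ℝ) ≤ q * N ∧ (q - 1) * N / 2 ≤ (⌊q * (N : ℝ)⌋₊ : ℝ) - N := by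
  have hqN : 0 ≤ q * (N : ℝ) := mul_nonneg (by linarith) (Nat.cast_nonneg N)
  have hfl : (⌊q * (N : ℝ)⌋₊ : ℝ) ≤ q * N := Nat.floor_le hqN
  have hlt : q * (N : ℝ) < ⌊q * (N : ℝ)⌋₊ + 1 := Nat.lt_floor_add_one _
  refine ⟨?_, hfl, by linarith⟩
  have h : (N : ℝ) < ⌊q * (N : ℝ)⌋₊ := by linarith
  exact_mod_cast h

/-- The lower window index: for q > 1 and `(q − 1)·N ≥ 2q`, `I := ⌈N∕q⌉₊` has `I < N`, `N∕q ≤ I` and `(q − 1)·N∕(2q) ≤ N − I`. [folklore] -/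
theorem lower_index {q : ℝ} (hq : 1 < q) {N : ℕ} (hN : 2 * q ≤ (q - 1) * N) :
    ⌈(N : ℝ) / q⌉₊ < N ∧ (N : ℝ) / q ≤ ⌈(N : ℝ) / q⌉₊ ∧ (q - 1) * N / (2 * q) ≤ (N : ℝ) - ⌈(N : ℝ) / q⌉₊ := by
  have hq0 : 0 < q := by linarith
  have hNq : 0 ≤ (N : ℝ) / q := div_nonneg (Nat.cast_nonneg N) hq0.le
  have hce : (N : ℝ) / q ≤ ⌈(N : ℝ) / q⌉₊ := Nat.le_ceil _
  have hlt : (⌈(N : ℝ) / q⌉₊ : ℝ) < (N : ℝ) / q + 1 := Nat.ceil_lt_add_one hNq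
  have hkey : (q - 1) * N / q = (N : ℝ) - N / q := by
    rw [sub_mul, one_mul, sub_div, mul_div_right_comm, div_self hq0.ne', one_mul]
  have h2 : 2 ≤ (N : ℝ) - N / q := by
    rw [← hkey, le_div_iff₀ hq0]; linarith
  refine ⟨?_, hce, ?_⟩
  · have h : (⌈(N : ℝ) / q⌉₊ : ℝ) < N := by linarith
    exact_mod_cast h
  · have h3 : (q - 1) * N / (2 * q) = ((N : ℝ) - N / q) / 2 := by rw [← hkey]; ring
    rw [h3]; linarith

/-- **THE (C,1) TAUBERIAN THEOREM FOR SEQUENCES UNDER ONE-SIDED SLOW DECREASE (HEADLINE).**  If the Cesàro means `n⁻¹·Σ_{i<n} a i → m` and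
a is SLOWLY DECREASING — for every ε > 0 there are q > 1 and N₀ with `a N − ε ≤ a i` whenever `N₀ ≤ N ≤ i` and `i ≤ q·N` — then
**`a n → m`**.  Upper bound on a N from the upper window [N, ⌊qN⌋[ (`upper_of_window`), lower bound from the lower window [⌈N∕q⌉, N[, on which
every base point i has `N ≤ q·i` (`lower_of_window`); the quotient errors are `≤ 2(q + 1)∕(q − 1)·η` resp. `≤ 4q∕(q − 1)·η` once the Cesàro means
are within η of m. [folklore] (R. Schmidt, Math. Z. 22 (1925); Hardy, Divergent Series Thm 68) -/
theorem tendsto_of_cesaro_slowlyDecreasing {m : ℝ}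
    (hces : Tendsto (fun n : ℕ => (n : ℝ)⁻¹ * ∑ i ∈ range n, a i) atTop (𝓝 m))
    (hsd : ∀ ε > 0, ∃ q > (1:ℝ), ∃ N₀ : ℕ, ∀ N i : ℕ, N₀ ≤ N → N ≤ i → (i : ℝ) ≤ q * N → a N - ε ≤ a i) :
    Tendsto a atTop (𝓝 m) := by
  rw [Metric.tendsto_atTop] at hces
  -- UPPER: ∀ ε > 0, eventually a N ≤ m + ε
  have hup : ∀ ε > 0, ∀ᶠ N in atTop, a N ≤ m + ε := by
    intro ε hε
    obtain ⟨q, hq, N₀, hsd'⟩ := hsd (ε / 2) (by linarith)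
    have hq1 : 0 < q - 1 := by linarith
    set η := ε / 2 * (q - 1) / (2 * (q + 1)) with hη
    have hη0 : 0 < η := by rw [hη]; positivity
    obtain ⟨N₂, hN₂⟩ := hces η hη0
    refine eventually_atTop.2 ⟨max (max N₀ N₂) ⌈2 / (q - 1)⌉₊, fun N hN => ?_⟩
    have hN0 : N₀ ≤ N := le_trans (le_max_left _ _) (le_trans (le_max_left _ _) hN)
    have hN2 : N₂ ≤ N := le_trans (le_max_right _ _) (le_trans (le_max_left _ _) hN)
    have hNc : ⌈2 / (q - 1)⌉₊ ≤ N := le_trans (le_max_right _ _) hN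
    have hN' : 2 ≤ (q - 1) * N := by
      have h : 2 / (q - 1) ≤ N := le_trans (Nat.le_ceil _) (Nat.cast_le.mpr hNc)
      rw [div_le_iff₀ hq1] at h; linarith
    obtain ⟨hNJ, hJq, hJN⟩ := upper_index hq hN'
    set J := ⌊q * (N : ℝ)⌋₊ with hJ
    have hJ2 : N₂ ≤ J := hN2.trans hNJ.le
    have hEJ : |(J : ℝ)⁻¹ * ∑ i ∈ range J, a i - m| ≤ η := by
      have := hN₂ J hJ2; rw [Real.dist_eq] at this; exact this.le
    have hEN : |(N : ℝ)⁻¹ * ∑ i ∈ range N, a i - m| ≤ η := by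
      have := hN₂ N hN2; rw [Real.dist_eq] at this; exact this.le
    have hw : ∀ i, N ≤ i → i < J → a N - ε / 2 ≤ a i := fun i h1 h2 =>
      hsd' N i hN0 h1 (le_trans (Nat.cast_le.mpr h2.le) hJq)
    have h := upper_of_window hNJ hw hEJ hEN
    -- the quotient error (J η + N η)/(J − N) ≤ (q+1)N η / ((q−1)N/2) = ε/2
    have hNpos : 0 < (N : ℝ) := by
      have : (q - 1) * 0 < (q - 1) * N := by rw [mul_zero]; linarith
      exact lt_of_mul_lt_mul_left this hq1.le
    have hJNpos : 0 < (J : ℝ) - N := by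
      have : 0 < (q - 1) * N / 2 := by positivity
      linarith
    have hquot : ((J : ℝ) * η + N * η) / ((J : ℝ) - N) ≤ ε / 2 := by
      rw [div_le_iff₀ hJNpos]
      have h1 : (J : ℝ) * η + N * η ≤ (q + 1) * N * η := by nlinarith
      have h2 : (q + 1) * N * η = ε / 2 * ((q - 1) * N / 2) := by
        rw [hη]; field_simp
      have h3 : ε / 2 * ((q - 1) * N / 2) ≤ ε / 2 * ((J : ℝ) - N) := mul_le_mul_of_nonneg_left hJN (by linarith)
      linarith
    linarith
  -- LOWER: ∀ ε > 0, eventually m − ε ≤ a N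
  have hlo : ∀ ε > 0, ∀ᶠ N in atTop, m - ε ≤ a N := by
    intro ε hε
    obtain ⟨q, hq, N₀, hsd'⟩ := hsd (ε / 2) (by linarith)
    have hq0 : 0 < q := by linarith
    have hq1 : 0 < q - 1 := by linarith
    set η := ε / 2 * (q - 1) / (4 * q) with hη
    have hη0 : 0 < η := by rw [hη]; positivity
    obtain ⟨N₂, hN₂⟩ := hces η hη0
    refine eventually_atTop.2 ⟨max (max N₂ ⌈q * (max N₀ N₂ : ℕ)⌉₊) ⌈2 * q / (q - 1)⌉₊, fun N hN => ?_⟩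
    have hN2 : N₂ ≤ N := le_trans (le_max_left _ _) (le_trans (le_max_left _ _) hN)
    have hNq : q * (max N₀ N₂ : ℕ) ≤ N :=
      le_trans (Nat.le_ceil _) (Nat.cast_le.mpr (le_trans (le_max_right _ _) (le_trans (le_max_left _ _) hN)))
    have hNc : ⌈2 * q / (q - 1)⌉₊ ≤ N := le_trans (le_max_right _ _) hN
    have hN' : 2 * q ≤ (q - 1) * N := by
      have h : 2 * q / (q - 1) ≤ N := le_trans (Nat.le_ceil _) (Nat.cast_le.mpr hNc)
      rw [div_le_iff₀ hq1] at h; linarith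
    obtain ⟨hIN, hIq, hNI⟩ := lower_index hq hN'
    set I := ⌈(N : ℝ) / q⌉₊ with hI
    -- I ≥ N/q ≥ max N₀ N₂
    have hImax : ((max N₀ N₂ : ℕ) : ℝ) ≤ I := by
      have h : ((max N₀ N₂ : ℕ) : ℝ) ≤ (N : ℝ) / q := by rw [le_div_iff₀ hq0]; linarith
      exact h.trans hIq
    have hImax' : max N₀ N₂ ≤ I := Nat.cast_le.mp hImax
    have hI0 : N₀ ≤ I := le_trans (le_max_left _ _) hImax'
    have hI2 : N₂ ≤ I := le_trans (le_max_right _ _) hImax'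
    have hEN : |(N : ℝ)⁻¹ * ∑ i ∈ range N, a i - m| ≤ η := by
      have := hN₂ N hN2; rw [Real.dist_eq] at this; exact this.le
    have hEI : |(I : ℝ)⁻¹ * ∑ i ∈ range I, a i - m| ≤ η := by
      have := hN₂ I hI2; rw [Real.dist_eq] at this; exact this.le
    have hw : ∀ i, I ≤ i → i < N → a i - ε / 2 ≤ a N := by
      intro i h1 h2
      have hi0 : N₀ ≤ i := hI0.trans h1
      have hiq : (N : ℝ) ≤ q * i := by
        have : (N : ℝ) / q ≤ i := hIq.trans (Nat.cast_le.mpr h1)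
        rw [div_le_iff₀ hq0] at this; linarith
      exact hsd' i N hi0 h2.le hiq
    have h := lower_of_window hIN hw hEN hEI
    have hNpos : 0 < (N : ℝ) := by
      have : (q - 1) * 0 < (q - 1) * N := by rw [mul_zero]; linarith
      exact lt_of_mul_lt_mul_left this hq1.le
    have hNIpos : 0 < (N : ℝ) - I := by
      have : 0 < (q - 1) * N / (2 * q) := by positivity
      linarith
    have hIleN : (I : ℝ) ≤ N := by exact_mod_cast hIN.le
    have hquot : ((N : ℝ) * η + I * η) / ((N : ℝ) - I) ≤ ε / 2 := by
      rw [div_le_iff₀ hNIpos]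
      have h1 : (N : ℝ) * η + I * η ≤ 2 * N * η := by nlinarith
      have h2 : 2 * N * η = ε / 2 * ((q - 1) * N / (2 * q)) := by
        rw [hη]; field_simp; norm_num
      have h3 : ε / 2 * ((q - 1) * N / (2 * q)) ≤ ε / 2 * ((N : ℝ) - I) := mul_le_mul_of_nonneg_left hNI (by linarith)
      linarith
    linarith
  -- conclusion in the order topology
  refine tendsto_order.2 ⟨fun b hb => ?_, fun b hb => ?_⟩
  · filter_upwards [hlo ((m - b) / 2) (by linarith)] with N hN
    linarith
  · filter_upwards [hup ((b - m) / 2) (by linarith)] with N hN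
    linarith

/-- **THE (C,1) TAUBERIAN THEOREM FOR SEQUENCES UNDER SLOW OSCILLATION.**  If `n⁻¹·Σ_{i<n} a i → m` and a is SLOWLY OSCILLATING at ∞ — for
every ε > 0 there are q > 1 and N₀ with `|a i − a N| ≤ ε` whenever `N₀ ≤ N ≤ i` and `i ≤ q·N` — then **`a n → m`**. [folklore]
(R. Schmidt 1925, two-sided case; Hardy, Divergent Series Thm 68) -/
theorem tendsto_of_cesaro_slowlyOscillating {m : ℝ}
    (hces : Tendsto (fun n : ℕ => (n : ℝ)⁻¹ * ∑ i ∈ range n, a i) atTop (𝓝 m))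
    (hso : ∀ ε > 0, ∃ q > (1:ℝ), ∃ N₀ : ℕ, ∀ N i : ℕ, N₀ ≤ N → N ≤ i → (i : ℝ) ≤ q * N → |a i - a N| ≤ ε) :
    Tendsto a atTop (𝓝 m) := by
  refine tendsto_of_cesaro_slowlyDecreasing hces fun ε hε => ?_
  obtain ⟨q, hq, N₀, h⟩ := hso ε hε
  exact ⟨q, hq, N₀, fun N i h0 h1 h2 => by have := (abs_le.mp (h N i h0 h1 h2)).1; linarith⟩

/-- A CONVERGENT SEQUENCE IS SLOWLY OSCILLATING (the class contains its conclusions; any q, here q = 2). [folklore] -/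
theorem slowlyOscillating_of_tendsto {L : ℝ} (ha : Tendsto a atTop (𝓝 L)) :
    ∀ ε > 0, ∃ q > (1:ℝ), ∃ N₀ : ℕ, ∀ N i : ℕ, N₀ ≤ N → N ≤ i → (i : ℝ) ≤ q * N → |a i - a N| ≤ ε := by
  intro ε hε
  obtain ⟨N₀, hN₀⟩ := (Metric.tendsto_atTop.mp ha) (ε / 2) (by linarith)
  refine ⟨2, by norm_num, N₀, fun N i h0 h1 _ => ?_⟩
  have hN := hN₀ N h0
  have hi := hN₀ i (h0.trans h1)
  rw [Real.dist_eq] at hN hi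
  calc |a i - a N| = |(a i - L) - (a N - L)| := by ring_nf
    _ ≤ |a i - L| + |a N - L| := abs_sub _ _
    _ ≤ ε := by linarith

/-- A LOG-LIPSCHITZ SEQUENCE IS SLOWLY OSCILLATING: `|a i − a N| ≤ K·log(i∕N)` for `N₀ ≤ N ≤ i` (K > 0, N₀ ≥ 1) ⟹ (SO) with `q = exp(ε∕K)`.
[folklore] -/
theorem slowlyOscillating_of_logLip {K : ℝ} (hK : 0 < K) {N₀ : ℕ} (hN₀ : 1 ≤ N₀)
    (hlip : ∀ N i : ℕ, N₀ ≤ N → N ≤ i → |a i - a N| ≤ K * Real.log ((i : ℝ) / N)) :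
    ∀ ε > 0, ∃ q > (1:ℝ), ∃ N₀ : ℕ, ∀ N i : ℕ, N₀ ≤ N → N ≤ i → (i : ℝ) ≤ q * N → |a i - a N| ≤ ε := by
  intro ε hε
  refine ⟨Real.exp (ε / K), Real.one_lt_exp_iff.mpr (div_pos hε hK), N₀, fun N i h0 h1 h2 => ?_⟩
  have hNpos : 0 < (N : ℝ) := Nat.cast_pos.mpr (lt_of_lt_of_le Nat.one_pos (hN₀.trans h0))
  have hipos : 0 < (i : ℝ) := Nat.cast_pos.mpr (lt_of_lt_of_le Nat.one_pos (hN₀.trans (h0.trans h1)))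
  have hratio : (i : ℝ) / N ≤ Real.exp (ε / K) := by rw [div_le_iff₀ hNpos]; exact h2
  have hlog : Real.log ((i : ℝ) / N) ≤ ε / K := by
    have := Real.log_le_log (div_pos hipos hNpos) hratio
    rwa [Real.log_exp] at this
  calc |a i - a N| ≤ K * Real.log ((i : ℝ) / N) := hlip N i h0 h1
    _ ≤ K * (ε / K) := mul_le_mul_of_nonneg_left hlog hK.le
    _ = ε := by field_simp

/-- **CESÀRO MEAN ⟺ LIMIT IN THE TAUBERIAN CLASS (sequences).**  If a is slowly oscillating at ∞ then for every m:
**`n⁻¹·Σ_{i<n} a i → m ⟺ a n → m`** (⟹ Schmidt; ⟸ Mathlib's `Filter.Tendsto.cesaro`, no clause). [folklore] -/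
theorem cesaro_iff_tendsto_of_slowlyOscillating
    (hso : ∀ ε > 0, ∃ q > (1:ℝ), ∃ N₀ : ℕ, ∀ N i : ℕ, N₀ ≤ N → N ≤ i → (i : ℝ) ≤ q * N → |a i - a N| ≤ ε) (m : ℝ) :
    Tendsto (fun n : ℕ => (n : ℝ)⁻¹ * ∑ i ∈ range n, a i) atTop (𝓝 m) ↔ Tendsto a atTop (𝓝 m) :=
  ⟨fun h => tendsto_of_cesaro_slowlyOscillating h hso, fun h => h.cesaro⟩

/-! ## §3 Perturbation by a null sequence, and the one-scale estimate as a rate -/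

/-- (SO) IS STABLE UNDER NULL PERTURBATIONS: u slowly oscillating and `e → 0` ⟹ `u + e` slowly oscillating. [folklore] -/
theorem slowlyOscillating_add_null {u e : ℕ → ℝ}
    (hso : ∀ ε > 0, ∃ q > (1:ℝ), ∃ N₀ : ℕ, ∀ N i : ℕ, N₀ ≤ N → N ≤ i → (i : ℝ) ≤ q * N → |u i - u N| ≤ ε)
    (he : Tendsto e atTop (𝓝 0)) :
    ∀ ε > 0, ∃ q > (1:ℝ), ∃ N₀ : ℕ, ∀ N i : ℕ, N₀ ≤ N → N ≤ i → (i : ℝ) ≤ q * N →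
      |(u i + e i) - (u N + e N)| ≤ ε := by
  intro ε hε
  obtain ⟨q, hq, N₀, h⟩ := hso (ε / 2) (by linarith)
  obtain ⟨N₁, hN₁⟩ := (Metric.tendsto_atTop.mp he) (ε / 4) (by linarith)
  refine ⟨q, hq, max N₀ N₁, fun N i h0 h1 h2 => ?_⟩
  have hu := h N i (le_trans (le_max_left _ _) h0) h1 h2
  have heN := hN₁ N (le_trans (le_max_right _ _) h0)
  have hei := hN₁ i ((le_trans (le_max_right _ _) h0).trans h1)
  rw [Real.dist_eq, sub_zero] at heN hei
  calc |(u i + e i) - (u N + e N)| = |(u i - u N) + (e i - e N)| := by ring_nf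
    _ ≤ |u i - u N| + |e i - e N| := abs_add_le _ _
    _ ≤ |u i - u N| + (|e i| + |e N|) := by gcongr; exact abs_sub _ _
    _ ≤ ε := by linarith

/-- **CESÀRO AVERAGING CANNOT CREATE THE LIMIT OF A SLOWLY OSCILLATING SEQUENCE PLUS A NULL SEQUENCE.**  For `d = u + e` with u slowly
oscillating at ∞ and `e → 0`, and every m:  **`n⁻¹·Σ_{i<n} d i → m ⟺ d → m ⟺ u → m`**.  (The shape of the consumer: d = the 1∕K letter
deviation of (3.76)'s O(1) term along the bare couplings = (1∕β₀²)·(three-loop Cesàro deviation at h_K) + O((1 + log K)²∕K), row L120.) [folklore] -/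
theorem cesaro_add_null_iff {u e : ℕ → ℝ}
    (hso : ∀ ε > 0, ∃ q > (1:ℝ), ∃ N₀ : ℕ, ∀ N i : ℕ, N₀ ≤ N → N ≤ i → (i : ℝ) ≤ q * N → |u i - u N| ≤ ε)
    (he : Tendsto e atTop (𝓝 0)) (m : ℝ) :
    (Tendsto (fun n : ℕ => (n : ℝ)⁻¹ * ∑ i ∈ range n, (u i + e i)) atTop (𝓝 m) ↔
        Tendsto (fun n => u n + e n) atTop (𝓝 m)) ∧
      (Tendsto (fun n => u n + e n) atTop (𝓝 m) ↔ Tendsto u atTop (𝓝 m)) := by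
  refine ⟨cesaro_iff_tendsto_of_slowlyOscillating (a := fun n => u n + e n) (slowlyOscillating_add_null hso he) m,
    ⟨fun h => ?_, fun h => by simpa using h.add he⟩⟩
  have := h.sub he
  simpa using this

/-- **THE ONE-SCALE ESTIMATE AS A RATE (log-Lipschitz class).**  If `|a i − a N| ≤ K·log(i∕N)` for `N₀ ≤ N ≤ i` (N₀ ≥ 1) and the Cesàro means obey
`|σ n − m| ≤ E n` for `n ≥ N₀`, then for all `N₀ ≤ N < J`:  **`|a N − m| ≤ K·log(J∕N) + (J·E J + N·E N)∕(J − N)`** — every window is admissible;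
J ≈ N(1 + √E) balances the two terms (the square-root law of P2 #51a, discretised). [folklore] -/
theorem logLip_rate {K : ℝ} (hK : 0 ≤ K) {N₀ : ℕ} (hN₀ : 1 ≤ N₀) {m : ℝ} {E : ℕ → ℝ}
    (hlip : ∀ N i : ℕ, N₀ ≤ N → N ≤ i → |a i - a N| ≤ K * Real.log ((i : ℝ) / N))
    (hE : ∀ n, N₀ ≤ n → |(n : ℝ)⁻¹ * ∑ i ∈ range n, a i - m| ≤ E n) {N J : ℕ} (hN : N₀ ≤ N) (hNJ : N < J) :
    |a N - m| ≤ K * Real.log ((J : ℝ) / N) + ((J : ℝ) * E J + N * E N) / ((J : ℝ) - N) := by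
  have hNpos : 0 < (N : ℝ) := Nat.cast_pos.mpr (lt_of_lt_of_le Nat.one_pos (hN₀.trans hN))
  refine one_scale hNJ (fun i h1 h2 => (hlip N i hN h1).trans ?_) (hE J (hN.trans hNJ.le)) (hE N hN)
  have hipos : 0 < (i : ℝ) := Nat.cast_pos.mpr (lt_of_lt_of_le Nat.one_pos ((hN₀.trans hN).trans h1))
  exact mul_le_mul_of_nonneg_left
    (Real.log_le_log (div_pos hipos hNpos) (div_le_div_of_nonneg_right (Nat.cast_le.mpr h2.le) hNpos.le)) hK

end

end Summit.QuantumFields.BalabanUV.Beta.EriceFlowEnclosureCesaroTauberianSeq
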